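import Literature.MathematicalPhysics.KineticTheory.CollisionFluxUpperBound
import Literature.MathematicalPhysics.KineticTheory.HardSphereCanonicalPairBound
import Summits.AtomisticToContinuum.HydrodynamicLimit.Theorems.JParityClosureCollisionTightnessSweptTube
import Summits.AtomisticToContinuum.HydrodynamicLimit.Theorems.JParityClosureCollisionTightnessTorusGibbs
import Summits.AtomisticToContinuum.HydrodynamicLimit.Theorems.JParityClosureOddContactSymmetryGibbsInvariance
import HarnessLib

/-!
# `InformationPercolationEngine.CollisionMomentBound` (stmt-AtomisticToContinuum-15144), rung 0:
# second velocity moments of the collision functional are tight under the homogeneous Gibbs law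

Helper file (`--supports stmt-AtomisticToContinuum-15144`).  The support item `CollisionMomentBound`
of route `InformationPercolationEngine` asks, for LOCAL Gibbs data with continuous profiles
`(a₀, u₀, θ₀)`, tightness uniformly in `N` of the velocity-weighted empirical collision functional
`K_N[1 + ‖vᵢ‖² + ‖vⱼ‖²] = ε_N (N+1)⁻¹ Σ_{collision times s ≤ τ} Σ_{ordered contact pairs (i,j)} (1 + ‖vᵢ(s)‖² + ‖vⱼ(s)‖²)`
of `N + 1` hard spheres of diameter `ε_N = σ (N+1)^{-1/3}` on `𝕋³`.  This file PROVES the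
constant-profile instance (`collisionMomentBound_const`: the decl body verbatim with
`a₀ ≡ a`, `u₀ ≡ u`, `θ₀ ≡ θ`), where the local Gibbs law is the homogeneous canonical Gibbs law
`G_N`, stationary under every hard-sphere flow (`measurePreserving_flow_localGibbsLaw_const`):

* `add_mul_one_add_sq_add_sq_le` — the pointwise inequality
  `(a + b)(1 + a² + b²) ≤ (a + 3a³) + (b + 3b³)` for `a, b ≥ 0`;
* `lintegral_fluxMoment_ne_top` — the flux-weighted Gaussian second moment
  `I(u, θ) = ∫ ‖w − v‖ (1 + ‖v‖² + ‖w‖²) dN(u,θ)(v) dN(u,θ)(w)` is finite (cubic Gaussian moments,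
  `IsGaussian.memLp_id`);
* `collisionMomentBound_const` — by the collision-flux upper bound
  `localGibbsLaw_collisionMarkSum_ge_le` (Markov + stationarity + Fatou over a time grid + the static
  one-window bound; Cercignani–Illner–Pulvirenti 1994 App. 4.A) fed with the swept tube
  (`exists_sweptTube`), the minimal-image lift inequality
  (`volume_setOf_exists_reprSym_add_latticeVec_mem_le`) and the Ruelle-type pair bound
  (`posGibbs_pairEvent_le`, small reduced density `exists_smallDensity`):
  `G_N{K_b < K_N[1 + ‖v‖² + ‖w‖²]} ≤ 16 τ σ³ I(u,θ) / K_b` for all `N ≥ 1` (`(N+1) ε_N³ = σ³`), so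
  `K_b = 16 τ σ³ I / δ + 1` does it, uniformly in `N`.

The item AS FILED (non-constant continuous profiles) is not settled by this: the local Gibbs law is
not invariant, and its comparison with `G_N` costs `Λ^{N+1}`
(`exists_localGibbsMeasure_le_smul_const`), so the transfer needs speed-`N` exponential upper tails of
the EQUILIBRIUM collision functional (see the companion file `…CollisionMomentBoundTransfer` and the
evidence memo on the item) — an open large-deviation estimate for the deterministic hard-sphere gas at
fixed reduced density.

References: C. Cercignani, R. Illner, M. Pulvirenti, *The Mathematical Theory of Dilute Gases*
(1994), App. 4.A; I. Gallagher, L. Saint-Raymond, B. Texier, *From Newton to Boltzmann* (2013),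
Prop. 4.1.1; H. Spohn, *Large Scale Dynamics of Interacting Particles* (1991), Part I §2.3.
-/

noncomputable section

open MeasureTheory Set Filter Topology
open scoped ENNReal InnerProductSpace BigOperators

namespace Summit.AtomisticToContinuum.HydrodynamicLimit.Theorems.CollisionMomentBound

open Literature.Analysis.FluidPDE Literature.MathematicalPhysics.KineticTheory

/-! ### The flux-weighted Gaussian second moment is finite -/

/-- `(a + b)(1 + a² + b²) ≤ (a + 3a³) + (b + 3b³)` for `a, b ≥ 0` (since `a²b + ab² ≤ a³ + b³`).
[folklore] -/
theorem add_mul_one_add_sq_add_sq_le {a b : ℝ} (ha : 0 ≤ a) (hb : 0 ≤ b) :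
    (a + b) * (1 + a ^ 2 + b ^ 2) ≤ (a + 3 * a ^ 3) + (b + 3 * b ^ 3) := by
  nlinarith [mul_nonneg (add_nonneg ha hb) (sq_nonneg (a - b)), mul_nonneg ha hb,
    pow_nonneg ha 3, pow_nonneg hb 3]

/-- The cubic absolute moment functional `‖v‖ + 3‖v‖³` is integrable under the Gaussian `N(u, θ)`.
[folklore] -/
theorem integrable_norm_add_norm_cube (u : V3) (θ : ℝ) :
    Integrable (fun v : V3 => ‖v‖ + 3 * ‖v‖ ^ 3) (gaussMeasure u θ) := by
  have h1 : Integrable (fun v : V3 => ‖v‖) (gaussMeasure u θ) := by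
    have := (ProbabilityTheory.IsGaussian.memLp_id (gaussMeasure u θ) ((1 : ℕ) : ℝ≥0∞)
      (by simp)).integrable_norm_pow one_ne_zero
    simpa using this
  have h3 : Integrable (fun v : V3 => ‖v‖ ^ 3) (gaussMeasure u θ) := by
    have := (ProbabilityTheory.IsGaussian.memLp_id (gaussMeasure u θ) ((3 : ℕ) : ℝ≥0∞)
      (by simp)).integrable_norm_pow (by norm_num)
    simpa using this
  exact h1.add (h3.const_mul 3)

/-- **The flux-weighted Gaussian second moment is finite**:
`∫ ‖w − v‖ (1 + ‖v‖² + ‖w‖²) dN(u,θ)(v) dN(u,θ)(w) < ∞`. [folklore] -/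
theorem lintegral_fluxMoment_ne_top (u : V3) (θ : ℝ) :
    ∫⁻ p, ENNReal.ofReal (‖p.2 - p.1‖ * (1 + ‖p.1‖ ^ 2 + ‖p.2‖ ^ 2))
        ∂((gaussMeasure u θ).prod (gaussMeasure u θ)) ≠ ⊤ := by
  set γ := gaussMeasure u θ with hγ
  set g : V3 → ℝ := fun v => ‖v‖ + 3 * ‖v‖ ^ 3 with hg
  have hg0 : ∀ v, 0 ≤ g v := fun v => by rw [hg]; positivity
  have hgi : Integrable g γ := integrable_norm_add_norm_cube u θ
  have hgm : Measurable fun v : V3 => ENNReal.ofReal (g v) := by rw [hg]; fun_prop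
  have hle : ∀ p : V3 × V3, ENNReal.ofReal (‖p.2 - p.1‖ * (1 + ‖p.1‖ ^ 2 + ‖p.2‖ ^ 2)) ≤
      ENNReal.ofReal (g p.1) + ENNReal.ofReal (g p.2) := by
    intro p
    rw [← ENNReal.ofReal_add (hg0 p.1) (hg0 p.2)]
    refine ENNReal.ofReal_le_ofReal ?_
    have h1 : ‖p.2 - p.1‖ ≤ ‖p.1‖ + ‖p.2‖ := by
      calc ‖p.2 - p.1‖ ≤ ‖p.2‖ + ‖p.1‖ := norm_sub_le _ _
        _ = ‖p.1‖ + ‖p.2‖ := add_comm _ _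
    calc ‖p.2 - p.1‖ * (1 + ‖p.1‖ ^ 2 + ‖p.2‖ ^ 2)
        ≤ (‖p.1‖ + ‖p.2‖) * (1 + ‖p.1‖ ^ 2 + ‖p.2‖ ^ 2) :=
          mul_le_mul_of_nonneg_right h1 (by positivity)
      _ ≤ g p.1 + g p.2 := add_mul_one_add_sq_add_sq_le (norm_nonneg _) (norm_nonneg _)
  have h1 : ∫⁻ p, ENNReal.ofReal (g p.1) ∂(γ.prod γ) = ∫⁻ v, ENNReal.ofReal (g v) ∂γ := by
    calc ∫⁻ p, ENNReal.ofReal (g p.1) ∂(γ.prod γ)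
        = ∫⁻ v, ∫⁻ _w, ENNReal.ofReal (g v) ∂γ ∂γ := lintegral_prod _ (hgm.comp measurable_fst).aemeasurable
      _ = ∫⁻ v, ENNReal.ofReal (g v) ∂γ := by simp only [lintegral_const, measure_univ, mul_one]
  have h2 : ∫⁻ p, ENNReal.ofReal (g p.2) ∂(γ.prod γ) = ∫⁻ v, ENNReal.ofReal (g v) ∂γ := by
    calc ∫⁻ p, ENNReal.ofReal (g p.2) ∂(γ.prod γ)
        = ∫⁻ _v, ∫⁻ w, ENNReal.ofReal (g w) ∂γ ∂γ := lintegral_prod _ (hgm.comp measurable_snd).aemeasurable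
      _ = ∫⁻ v, ENNReal.ofReal (g v) ∂γ := by simp only [lintegral_const, measure_univ, mul_one]
  have hfin : ∫⁻ v, ENNReal.ofReal (g v) ∂γ < ⊤ := hgi.lintegral_lt_top
  refine ne_of_lt ?_
  calc ∫⁻ p, ENNReal.ofReal (‖p.2 - p.1‖ * (1 + ‖p.1‖ ^ 2 + ‖p.2‖ ^ 2)) ∂(γ.prod γ)
      ≤ ∫⁻ p, (ENNReal.ofReal (g p.1) + ENNReal.ofReal (g p.2)) ∂(γ.prod γ) := lintegral_mono hle
    _ = ∫⁻ v, ENNReal.ofReal (g v) ∂γ + ∫⁻ v, ENNReal.ofReal (g v) ∂γ := by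
        rw [lintegral_add_left (show Measurable (fun p : V3 × V3 => ENNReal.ofReal (g p.1)) from
          hgm.comp measurable_fst), h1, h2]
    _ < ⊤ := ENNReal.add_lt_top.2 ⟨hfin, hfin⟩

/-! ### Rung 0: the constant-profile instance of `CollisionMomentBound` -/

/-- **`CollisionMomentBound` at rung 0 (constant profiles = the flow-invariant homogeneous Gibbs
law).** For `a, θ > 0`, `u`, there is `σ₀ > 0` such that for every `0 < σ < σ₀`, every family of
hard-sphere flows `Φ_N` of `N + 1` spheres of diameter `ε_N = hsDiameter σ N` on `𝕋³`, every `τ > 0`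
and `δ > 0` there are `K_b` and `N₀` (here `N₀ = 1`, `K_b = 16 τ σ³ I(u,θ)/δ + 1`) with
`G_N{K_b < ε_N (N+1)⁻¹ Σ_{collision times s ∈ [0,τ]} Σ_{ordered contact pairs (i,j)} (1 + ‖vᵢ(s)‖² + ‖vⱼ(s)‖²)} ≤ δ`
for all `N ≥ N₀`, `G_N = localGibbsLaw σ a u θ N Φ_N` — the body of the route decl
`InformationPercolationEngine.CollisionMomentBound` with constant profiles.  Proof: the collision-flux
upper bound `localGibbsLaw_collisionMarkSum_ge_le` for the mark `b(v, w) = 1 + ‖v‖² + ‖w‖²` and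
`(N+1) ε_N³ = σ³`. [folklore] -/
theorem collisionMomentBound_const {a θ : ℝ} (ha : 0 < a) (hθ : 0 < θ) (u : V3) :
    ∃ σ₀ : ℝ, 0 < σ₀ ∧ ∀ σ : ℝ, 0 < σ → σ < σ₀ →
      ∀ Φ : (N : ℕ) → HardSphereFlow (Torus.geometry (Fin 3)) (hsDiameter σ N) (N + 1),
      ∀ τ : ℝ, 0 < τ → ∀ δ : ℝ, 0 < δ → ∃ Kb : ℝ, ∃ N₀ : ℕ, ∀ N : ℕ, N₀ ≤ N →
        let ε := hsDiameter σ N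
        let G : Geometry (Fin 3) T3 := Torus.geometry (Fin 3)
        let γ : Config (N + 1) (Fin 3) T3 → ℝ → Config (N + 1) (Fin 3) T3 := fun z s => (Φ N).flow s z
        let Kc : (Config (N + 1) (Fin 3) T3 → ℝ → Fin (N + 1) → Fin (N + 1) → ℝ) →
            Config (N + 1) (Fin 3) T3 → ℝ := fun F z => ε / (N + 1 : ℝ) *
          ∑ᶠ (s : ℝ) (_ : s ∈ collisionTimes G ε (γ z) ∩ Set.Icc 0 τ),
            ∑ i : Fin (N + 1), ∑ j : Fin (N + 1),
              (if i ≠ j ∧ ‖G.sepVec (γ z s i).1 (γ z s j).1‖ = ε then F z s i j else 0)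
        localGibbsLaw σ (fun _ => a) (fun _ => u) (fun _ => θ) N (Φ N)
            {z | Kb < Kc (fun z s i j => 1 + ‖(γ z s i).2‖ ^ 2 + ‖(γ z s j).2‖ ^ 2) z} ≤
          ENNReal.ofReal δ := by
  obtain ⟨σ₀, hσ₀, hsmall⟩ := exists_smallDensity uniformProfile one_pos
  refine ⟨σ₀, hσ₀, fun σ hσ hσlt Φ τ hτ δ hδ => ?_⟩
  have hsm : SmallDensity uniformProfile σ := (hsmall σ hσ hσlt).1
  -- the Gaussian flux-weighted second moment and the threshold
  set b : V3 × V3 → ℝ := fun p => 1 + ‖p.1‖ ^ 2 + ‖p.2‖ ^ 2 with hb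
  have hbm : Measurable b := by rw [hb]; fun_prop
  have hb0 : ∀ p, 0 ≤ b p := fun p => by rw [hb]; positivity
  set I : ℝ≥0∞ := ∫⁻ p, ENNReal.ofReal (‖p.2 - p.1‖ * b p)
    ∂((gaussMeasure u θ).prod (gaussMeasure u θ)) with hI
  have hItop : I ≠ ⊤ := lintegral_fluxMoment_ne_top u θ
  set Ir : ℝ := I.toReal with hIr
  have hIr0 : 0 ≤ Ir := ENNReal.toReal_nonneg
  have hIeq : I = ENNReal.ofReal Ir := (ENNReal.ofReal_toReal hItop).symm
  set Kb : ℝ := 16 * τ * σ ^ 3 * Ir / δ + 1 with hKb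
  have hKb0 : 0 < Kb := by rw [hKb]; positivity
  refine ⟨Kb, 1, fun N hN => ?_⟩
  -- notation
  set ε := hsDiameter σ N with hεdef
  have hε : 0 < ε := hsDiameter_pos hσ N
  set P := localGibbsLaw σ (fun _ => a) (fun _ => u) (fun _ => θ) N (Φ N) with hP
  set Mu : ℝ := ε / (N + 1 : ℝ) with hMu
  have hMu0 : 0 < Mu := by rw [hMu]; positivity
  set η' : ℝ := Kb / Mu with hη'
  have hη'0 : 0 < η' := div_pos hKb0 hMu0
  -- the event of a large `b`-collision sum on the good set
  set B : Set (Config (N + 1) (Fin 3) T3) := {z | z ∈ (Φ N).good ∧ η' ≤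
      ∑ᶠ s ∈ collisionTimes (Torus.geometry (Fin 3)) ε (fun t => (Φ N).flow t z) ∩ Icc 0 τ,
        ∑ i : Fin (N + 1), ∑ j : Fin (N + 1),
          (if i ≠ j ∧ ‖(Torus.geometry (Fin 3)).sepVec ((Φ N).flow s z i).1 ((Φ N).flow s z j).1‖ = ε
            then b (((Φ N).flow s z i).2, ((Φ N).flow s z j).2) else 0)} with hB
  have hsub : {z : Config (N + 1) (Fin 3) T3 | Kb < Mu *
      ∑ᶠ (s : ℝ) (_ : s ∈ collisionTimes (Torus.geometry (Fin 3)) ε (fun t => (Φ N).flow t z) ∩ Icc 0 τ),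
        ∑ i : Fin (N + 1), ∑ j : Fin (N + 1),
          (if i ≠ j ∧ ‖(Torus.geometry (Fin 3)).sepVec ((Φ N).flow s z i).1 ((Φ N).flow s z j).1‖ = ε
            then 1 + ‖((Φ N).flow s z i).2‖ ^ 2 + ‖((Φ N).flow s z j).2‖ ^ 2 else 0)} ⊆
      (Φ N).goodᶜ ∪ B := by
    intro z hz
    by_cases hgood : z ∈ (Φ N).good
    · refine Or.inr ⟨hgood, ?_⟩
      rw [hη']
      exact (div_le_iff₀' hMu0).2 (le_of_lt hz)
    · exact Or.inl hgood
  have hgood0 : P (Φ N).goodᶜ = 0 := by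
    rw [hP, localGibbsLaw_eq]
    exact localGibbsMeasure_absolutelyContinuous σ _ _ _ N (Φ N) (Φ N).measure_compl_good
  have hBle := localGibbsLaw_collisionMarkSum_ge_le hsm.σ_lt_half.le ha hθ u (Φ N)
    (measurePreserving_flow_localGibbsLaw_const σ a θ u N (Φ N))
    (fun i j hij T hT => posGibbs_pairEvent_le hsm hN hij hT)
    (fun h hh => exists_sweptTube (hsDiameter_pos hσ N) hh)
    (fun S hS => by simpa only [sub_zero] using volume_setOf_exists_reprSym_add_latticeVec_mem_le 0 hS)
    hτ hbm hb0 hη'0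
  -- the arithmetic of the constants
  have hε3 : ((N + 1 : ℕ) : ℝ) * ε ^ 3 = σ ^ 3 := succ_mul_hsDiameter_pow_three σ N
  have hkey : η'⁻¹ * (16 * τ * ((N + 1 : ℕ) : ℝ) ^ 2 * ε ^ 2) * Ir ≤ δ := by
    have h1 : η'⁻¹ * (16 * τ * ((N + 1 : ℕ) : ℝ) ^ 2 * ε ^ 2) * Ir =
        16 * τ * (((N + 1 : ℕ) : ℝ) * ε ^ 3) * Ir / Kb := by
      rw [hη', hMu]
      push_cast
      field_simp
    rw [h1, hε3, div_le_iff₀ hKb0, hKb, mul_add, mul_one, mul_div_cancel₀ _ hδ.ne']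
    linarith [mul_nonneg (mul_nonneg (mul_nonneg (by norm_num : (0 : ℝ) ≤ 16) hτ.le)
      (pow_nonneg hσ.le 3)) hIr0]
  show P _ ≤ ENNReal.ofReal δ
  calc P _ ≤ P ((Φ N).goodᶜ ∪ B) := measure_mono hsub
    _ ≤ P (Φ N).goodᶜ + P B := measure_union_le _ _
    _ ≤ 0 + (ENNReal.ofReal η')⁻¹ * (ENNReal.ofReal (16 * τ * ((N + 1 : ℕ) : ℝ) ^ 2 * ε ^ 2) * I) := by
        rw [hgood0]
        exact add_le_add le_rfl hBle
    _ = ENNReal.ofReal (η'⁻¹ * (16 * τ * ((N + 1 : ℕ) : ℝ) ^ 2 * ε ^ 2) * Ir) := by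
        rw [zero_add, hIeq, ← ENNReal.ofReal_inv_of_pos hη'0,
          ← ENNReal.ofReal_mul (by positivity), ← ENNReal.ofReal_mul (by positivity)]
        congr 1
        ring
    _ ≤ ENNReal.ofReal δ := ENNReal.ofReal_le_ofReal hkey

end Summit.AtomisticToContinuum.HydrodynamicLimit.Theorems.CollisionMomentBound

end
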